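import Summits.NavierStokesRegularity.FluidComputer.LevelTransferFloor
import HarnessLib

/-!
# Fluid computer — L13: the HAND-OFF CLOCK FLOOR (a transfer into a level takes at least a coarse-strain time)

HONEST FRAMING (cell `pub-fluidc`, verbatim): *low prior, high value-of-information experiment on Tao's
machine paradigm; NOT a claim that NS blows up.* Theorem side of the cell (necessities / ceilings every cascade
design must respect); nothing here is evidence of blow-up.

The transfer ceiling L12″ (`LevelTransferFloor.blockL2_sq_le_add_local`: along every maximal smooth finite-energy
solution, `‖Δ̇_j u(t)‖₂² ≤ ‖Δ̇_j u(s)‖₂² + 2 ∫⁻_{(s,t]} A·( a_j ∑_{|m|≤2} a_{j+m} T_{j+m} + s_j Q_j ) dτ`, with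
`a_l = ‖Δ̇_l u‖₂`, `s_l = ‖Δ̇_l u‖_∞`, `T_l = ∑_{l' ≤ l-3} 2^{l'} s_{l'}` the Lipschitz size of the coarser levels and `Q_j`
the weighted energy pairs of comparable-or-finer levels) bounds the GROWTH RATE of a level by its neighbours and the
coarse strain. Read with amplitude bounds on the window it is a CLOCK:

* `blockL2_sq_le_add_clock` (**L13 — THE HAND-OFF CLOCK FLOOR**) — if on `(s, t]` the local pair amplitudes are at
  most `ā` (`a_{j+m}(τ) ≤ ā`, `|m| ≤ 2`), the coarse strains at most `T̄` (`T_{j+m}(τ) ≤ T̄`) and the fine-pair channel at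
  most `q̄` (`s_j(τ) Q_j(τ) ≤ q̄`), then `‖Δ̇_j u(t)‖₂² ≤ ‖Δ̇_j u(s)‖₂² + 2 (t − s) · A (5 ā² T̄ + q̄)`: delivering the
  energy `ΔE_j` into level `j` takes at least `ΔE_j / (2A(5 ā² T̄ + q̄))`. With the fine-pair channel idle and an energy to
  deliver comparable to the neighbours' own (`ΔE_j ≈ ā²`) this is a fixed fraction `1/(10 A)` of the COARSE STRAIN TIME
  `1/T̄` — the eddy turn-over clock of the cell's spec sheet (HOME/PLAN.md §0: `T_n ≲ c_T/(k_n U_n)` as a design target)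
  read from BELOW: no hand-off is faster than the strain of the levels beneath it allows. The occupation floors
  (`OccupationFloorsHold`) bound dwell times of the saturation front from below at infinitely many levels; this clock
  bounds EVERY single transfer, at every level and every pair of times, conditionally on the observed amplitudes —
  exactly the quantities the atlas tabulates (band energies, band sups, `T_½`).
* `clock_le_of_transfer` (**L13′**, the same solved for the time) — `ΔE_j ≤ 2 (t−s) A (5ā²T̄ + q̄)` rewritten as
  `ofReal (t − s) ≥ (‖Δ̇_j u(t)‖₂² − ‖Δ̇_j u(s)‖₂²) / (2 A (5 ā² T̄ + q̄))` in `ℝ≥0∞` (truncated subtraction and division).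

* `capacity_floor` (**L12‴ — THE CAPACITY FLOOR**, appended) — the transfer floor read through the clock:
  at infinitely many levels of every terminal window `sup_{(t₀,T)} G_j ≥ c ν² / (A 2^j (T − t₀))`, `G_j` the local
  transfer capacity `a_j ∑_{|m|≤2} a_{j+m} T_{j+m} + s_j Q_j` — the instantaneous local feeding must diverge at least
  like `(T − t₀)^{-1}` as the window closes on the singular time.

0 sorry; no new definitions, no named facts (inputs: `LevelTransferFloor.blockL2_sq_le_add_local`,
`LevelTransferFloor.transfer_floor_local`).

## References

* A. Cheskidov, M. Dai, *Regularity criteria for the 3D Navier–Stokes and MHD equations*, arXiv:1507.06611 =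
  Proc. Edinburgh Math. Soc. (2025), §3.1, (3.6). [CheskidovDai2015]
* A. Cheskidov, R. Shvydkoy, Arch. Ration. Mech. Anal. 195 (2010) 159–169 = arXiv:0708.3067, Lemma 3.2 (proof, (8)).
  [CheskidovShvydkoy2010]
-/

noncomputable section

open MeasureTheory Set Function Filter Topology
open scoped ENNReal NNReal RealInnerProductSpace
open Literature.Analysis.FluidPDE Literature.Analysis.FunctionSpaces

namespace Summit.NavierStokesRegularity.FluidComputer.LevelTransferClock

/-- **L13 — THE HAND-OFF CLOCK FLOOR.** There is an absolute FINITE constant `A` (the Littlewood–Paley constant of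
`LevelTransferFloor.blockL2_sq_le_add_local`) such that for every `ν > 0`, `T > 0`, every maximal smooth solution
`(u, p)` of the unforced Navier–Stokes system on `ℝ³ × [0, T)` which is Leray–Hopf from `u 0`, all `0 < s ≤ t < T`, every
level `j ∈ ℤ` and all bounds `ā, T̄, q̄ ∈ [0, ∞]` on the window `(s, t]` — local pair amplitudes
`‖Δ̇_{j+m} u(τ)‖₂ ≤ ā` (`|m| ≤ 2`), coarse strains `T_{j+m}(u(τ)) = ∑_{l ≤ j+m-3} 2^l ‖Δ̇_l u(τ)‖_∞ ≤ T̄` (`|m| ≤ 2`) and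
fine-pair channel `‖Δ̇_j u(τ)‖_∞ · Q_j(u(τ)) ≤ q̄` —
`‖Δ̇_j u(t)‖₂² ≤ ‖Δ̇_j u(s)‖₂² + 2 (t − s) · A · (5 ā² T̄ + q̄)`.
So the energy `ΔE_j` handed into level `j` during `(s, t]` costs at least the time `ΔE_j / (2 A (5 ā² T̄ + q̄))`; with the
fine-pair channel idle (`q̄ = 0`) and `ΔE_j` comparable to the neighbours' energy `ā²`, at least the fixed fraction
`1/(10A)` of the coarse strain time `1/T̄`. Proof: the transfer ceiling L12″ with its integrand bounded by the constant
`A (ā · 5 ā T̄ + q̄)` on `(s, t]` and `∫⁻_{(s,t]} 1 = t − s`. [cite: CheskidovDai2015, §3.1 (3.6)] -/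
theorem blockL2_sq_le_add_clock :
    ∃ A : ℝ≥0∞, A ≠ ∞ ∧ ∀ (ν T : ℝ), 0 < ν → 0 < T →
      ∀ (u : ℝ → EuclideanSpace ℝ (Fin 3) → EuclideanSpace ℝ (Fin 3)) (p : ℝ → EuclideanSpace ℝ (Fin 3) → ℝ),
      IsMaximalSmoothSolution ν 0 u p T → IsLerayHopfOn T ν 0 (u 0) u →
      ∀ s t : ℝ, 0 < s → s ≤ t → t < T → ∀ (j : ℤ) (abar Tbar qbar : ℝ≥0∞),
        (∀ τ ∈ Ioc s t, ∀ m ∈ Finset.Icc (-2 : ℤ) 2, blockL2 (u τ) (j + m) ≤ abar) →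
        (∀ τ ∈ Ioc s t, ∀ m ∈ Finset.Icc (-2 : ℤ) 2,
          paraT (fun l => (2 : ℝ≥0∞) ^ l * blockSup (u τ) l) (j + m) ≤ Tbar) →
        (∀ τ ∈ Ioc s t, blockSup (u τ) j *
          paraQ2 (blockL2 (u τ)) (fun l => (2 : ℝ≥0∞) ^ l * blockL2 (u τ) l) j ≤ qbar) →
        blockL2 (u t) j ^ 2 ≤ blockL2 (u s) j ^ 2 +
          2 * ENNReal.ofReal (t - s) * (A * (5 * abar ^ 2 * Tbar + qbar)) := by
  obtain ⟨A, hA, H⟩ := LevelTransferFloor.blockL2_sq_le_add_local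
  refine ⟨A, hA, fun ν T hν hT u p hmax hLH s t hs hst htT j abar Tbar qbar ha hT' hq => ?_⟩
  refine (H ν T hν hT u p hmax hLH s t hs hst htT j).trans ?_
  -- the integrand is bounded by a constant on `(s, t]`
  have hbd : ∀ τ ∈ Ioc s t,
      A * (blockL2 (u τ) j * ∑ m ∈ Finset.Icc (-2 : ℤ) 2, blockL2 (u τ) (j + m) *
            paraT (fun l => (2 : ℝ≥0∞) ^ l * blockSup (u τ) l) (j + m) +
          blockSup (u τ) j * paraQ2 (blockL2 (u τ)) (fun l => (2 : ℝ≥0∞) ^ l * blockL2 (u τ) l) j) ≤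
        A * (5 * abar ^ 2 * Tbar + qbar) := by
    intro τ hτ
    have h0 : blockL2 (u τ) j ≤ abar := by simpa using ha τ hτ 0 (by simp)
    have hsum : ∑ m ∈ Finset.Icc (-2 : ℤ) 2, blockL2 (u τ) (j + m) *
        paraT (fun l => (2 : ℝ≥0∞) ^ l * blockSup (u τ) l) (j + m) ≤ 5 * (abar * Tbar) := by
      calc ∑ m ∈ Finset.Icc (-2 : ℤ) 2, blockL2 (u τ) (j + m) *
            paraT (fun l => (2 : ℝ≥0∞) ^ l * blockSup (u τ) l) (j + m)
          ≤ ∑ m ∈ Finset.Icc (-2 : ℤ) 2, abar * Tbar :=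
            Finset.sum_le_sum fun m hm => mul_le_mul' (ha τ hτ m hm) (hT' τ hτ m hm)
        _ = 5 * (abar * Tbar) := by
            have hcard : (Finset.Icc (-2 : ℤ) 2).card = 5 := by rw [Int.card_Icc]; rfl
            rw [Finset.sum_const, hcard, nsmul_eq_mul, Nat.cast_ofNat]
    calc A * (blockL2 (u τ) j * ∑ m ∈ Finset.Icc (-2 : ℤ) 2, blockL2 (u τ) (j + m) *
              paraT (fun l => (2 : ℝ≥0∞) ^ l * blockSup (u τ) l) (j + m) +
            blockSup (u τ) j * paraQ2 (blockL2 (u τ)) (fun l => (2 : ℝ≥0∞) ^ l * blockL2 (u τ) l) j)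
        ≤ A * (abar * (5 * (abar * Tbar)) + qbar) := by gcongr; exact hq τ hτ
      _ = A * (5 * abar ^ 2 * Tbar + qbar) := by ring
  calc blockL2 (u s) j ^ 2 + 2 * ∫⁻ τ in Ioc s t,
          A * (blockL2 (u τ) j * ∑ m ∈ Finset.Icc (-2 : ℤ) 2, blockL2 (u τ) (j + m) *
              paraT (fun l => (2 : ℝ≥0∞) ^ l * blockSup (u τ) l) (j + m) +
            blockSup (u τ) j * paraQ2 (blockL2 (u τ)) (fun l => (2 : ℝ≥0∞) ^ l * blockL2 (u τ) l) j)
      ≤ blockL2 (u s) j ^ 2 + 2 * ∫⁻ _ in Ioc s t, A * (5 * abar ^ 2 * Tbar + qbar) := by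
        gcongr blockL2 (u s) j ^ 2 + 2 * ?_
        exact setLIntegral_mono' measurableSet_Ioc hbd
    _ = blockL2 (u s) j ^ 2 + 2 * ENNReal.ofReal (t - s) * (A * (5 * abar ^ 2 * Tbar + qbar)) := by
        rw [setLIntegral_const, Real.volume_Ioc]; ring

/-- **L13′ — the clock, solved for the time.** In the setting of `blockL2_sq_le_add_clock` (same constant `A`):
`(‖Δ̇_j u(t)‖₂² − ‖Δ̇_j u(s)‖₂²) / (2 A (5 ā² T̄ + q̄)) ≤ t − s` in `[0, ∞]` (truncated subtraction, extended division):
the time a transfer into level `j` takes is at least the energy delivered divided by twice the capacity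
`A (5 ā² T̄ + q̄)` of the two local channels on the window. [cite: CheskidovDai2015, §3.1 (3.6)] -/
theorem clock_le_of_transfer :
    ∃ A : ℝ≥0∞, A ≠ ∞ ∧ ∀ (ν T : ℝ), 0 < ν → 0 < T →
      ∀ (u : ℝ → EuclideanSpace ℝ (Fin 3) → EuclideanSpace ℝ (Fin 3)) (p : ℝ → EuclideanSpace ℝ (Fin 3) → ℝ),
      IsMaximalSmoothSolution ν 0 u p T → IsLerayHopfOn T ν 0 (u 0) u →
      ∀ s t : ℝ, 0 < s → s ≤ t → t < T → ∀ (j : ℤ) (abar Tbar qbar : ℝ≥0∞),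
        (∀ τ ∈ Ioc s t, ∀ m ∈ Finset.Icc (-2 : ℤ) 2, blockL2 (u τ) (j + m) ≤ abar) →
        (∀ τ ∈ Ioc s t, ∀ m ∈ Finset.Icc (-2 : ℤ) 2,
          paraT (fun l => (2 : ℝ≥0∞) ^ l * blockSup (u τ) l) (j + m) ≤ Tbar) →
        (∀ τ ∈ Ioc s t, blockSup (u τ) j *
          paraQ2 (blockL2 (u τ)) (fun l => (2 : ℝ≥0∞) ^ l * blockL2 (u τ) l) j ≤ qbar) →
        (blockL2 (u t) j ^ 2 - blockL2 (u s) j ^ 2) / (2 * (A * (5 * abar ^ 2 * Tbar + qbar))) ≤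
          ENNReal.ofReal (t - s) := by
  obtain ⟨A, hA, H⟩ := blockL2_sq_le_add_clock
  refine ⟨A, hA, fun ν T hν hT u p hmax hLH s t hs hst htT j abar Tbar qbar ha hT' hq => ?_⟩
  have h := H ν T hν hT u p hmax hLH s t hs hst htT j abar Tbar qbar ha hT' hq
  have hsub : blockL2 (u t) j ^ 2 - blockL2 (u s) j ^ 2 ≤
      ENNReal.ofReal (t - s) * (2 * (A * (5 * abar ^ 2 * Tbar + qbar))) := by
    rw [tsub_le_iff_left, ← mul_assoc, mul_comm (ENNReal.ofReal (t - s)) 2]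
    exact h
  exact ENNReal.div_le_of_le_mul hsub

/-! ## L12‴ — the capacity floor: the local transfer capacity diverges like `(T − t₀)⁻¹` -/

/-- **L12‴ — THE CAPACITY FLOOR (the floor read through the clock).** With the absolute constants `c > 0` and
`A < ∞` of `LevelTransferFloor.transfer_floor_local`: for every `ν > 0`, `T > 0`, every maximal smooth solution
`(u, p)` of the unforced Navier–Stokes system on `ℝ³ × [0, T)` which is Leray–Hopf from `u 0`, and every
`t₀ ∈ [0, T)`: at INFINITELY MANY levels `j`,
`c ν² ≤ 2^j · (T − t₀) · A · sup_{τ ∈ (t₀,T)} G_j(u(τ))`, `G_j = a_j ∑_{|m|≤2} a_{j+m} T_{j+m} + s_j Q_j`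
the LOCAL TRANSFER CAPACITY of level `j` (notation of `transfer_floor_local`). The lower integral over the window is at
most the window length times the supremum, so the transfer floor `c ν² ≤ 2^j ∫⁻_{(t₀,T)} A G_j` forces
`sup_{(t₀,T)} G_j ≥ c ν² / (A 2^j (T − t₀))`: the later the window, the more violent the local feeding — along any
realised blow-up the instantaneous local capacity must, at infinitely many levels of every terminal window, exceed a
multiple of `ν² 2^{-j} (T − t₀)^{-1}`; a cascade whose local pair amplitudes and coarse strains stay bounded near its
would-be singular time feeds no blow-up. Necessity only; nothing about any fixed finite set of levels.
[cite: CheskidovDai2015, §3.1 (3.6)] -/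
theorem capacity_floor :
    ∃ (c : ℝ) (A : ℝ≥0∞), 0 < c ∧ A ≠ ∞ ∧ ∀ (ν T : ℝ), 0 < ν → 0 < T →
      ∀ (u : ℝ → EuclideanSpace ℝ (Fin 3) → EuclideanSpace ℝ (Fin 3)) (p : ℝ → EuclideanSpace ℝ (Fin 3) → ℝ),
      IsMaximalSmoothSolution ν 0 u p T → IsLerayHopfOn T ν 0 (u 0) u →
      ∀ t₀ ∈ Ico 0 T, ∃ᶠ j : ℕ in atTop,
        ENNReal.ofReal (c * ν ^ 2) ≤ (2 : ℝ≥0∞) ^ j * ENNReal.ofReal (T - t₀) * A *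
          ⨆ τ ∈ Ioo t₀ T,
            (blockL2 (u τ) j * ∑ m ∈ Finset.Icc (-2 : ℤ) 2, blockL2 (u τ) ((j : ℤ) + m) *
                paraT (fun l => (2 : ℝ≥0∞) ^ l * blockSup (u τ) l) ((j : ℤ) + m) +
              blockSup (u τ) j * paraQ2 (blockL2 (u τ)) (fun l => (2 : ℝ≥0∞) ^ l * blockL2 (u τ) l) j) := by
  obtain ⟨c, A, hc, hA, H⟩ := LevelTransferFloor.transfer_floor_local
  refine ⟨c, A, hc, hA, fun ν T hν hT u p hmax hLH t₀ ht₀ => ?_⟩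
  refine (H ν T hν hT u p hmax hLH t₀ ht₀).mono fun j hj => hj.trans ?_
  set G : ℝ → ℝ≥0∞ := fun τ =>
    blockL2 (u τ) j * ∑ m ∈ Finset.Icc (-2 : ℤ) 2, blockL2 (u τ) ((j : ℤ) + m) *
        paraT (fun l => (2 : ℝ≥0∞) ^ l * blockSup (u τ) l) ((j : ℤ) + m) +
      blockSup (u τ) j * paraQ2 (blockL2 (u τ)) (fun l => (2 : ℝ≥0∞) ^ l * blockL2 (u τ) l) j with hG
  have hle : ∫⁻ τ in Ioo t₀ T, A * G τ ≤ ∫⁻ _ in Ioo t₀ T, A * ⨆ τ ∈ Ioo t₀ T, G τ :=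
    setLIntegral_mono' measurableSet_Ioo fun τ hτ => by
      gcongr
      exact le_iSup₂ (f := fun τ (_ : τ ∈ Ioo t₀ T) => G τ) τ hτ
  calc (2 : ℝ≥0∞) ^ j * ∫⁻ τ in Ioo t₀ T, A * G τ
      ≤ (2 : ℝ≥0∞) ^ j * ∫⁻ _ in Ioo t₀ T, A * ⨆ τ ∈ Ioo t₀ T, G τ := by gcongr
    _ = (2 : ℝ≥0∞) ^ j * ENNReal.ofReal (T - t₀) * A * ⨆ τ ∈ Ioo t₀ T, G τ := by
        rw [setLIntegral_const, Real.volume_Ioo]; ring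

end Summit.NavierStokesRegularity.FluidComputer.LevelTransferClock

end
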